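import Summits.QuantumFields.YangMills.Theses.AllWindowsColdBox
import Summits.QuantumFields.YangMills.Theorems.AllWindowsColdBoxBoxHighWindowsSU22LineDefs
import Summits.QuantumFields.YangMills.Theorems.AllWindowsColdBoxBoxHighLineHodgeBootstrap
import Summits.QuantumFields.YangMills.Theorems.AllWindowsColdBoxBoxHighLineGaugeBallOfBootstrap
import Summits.QuantumFields.YangMills.Theorems.AllWindowsColdBoxBoxWindowHighSU2213LineDefs
import Summits.QuantumFields.YangMills.Theorems.AllWindowsColdBoxBoxHighLineLandauBallUniqueness
import Summits.QuantumFields.YangMills.Theorems.AllWindowsColdBoxBoxHighLineBulkCurrency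
import Summits.QuantumFields.YangMills.Theorems.AllWindowsColdBoxBoxHighLineLandauKernelGradDipole
import Summits.QuantumFields.YangMills.Theorems.AllWindowsColdBoxBoxHighLineLandauRepresentativeStrong
import Summits.QuantumFields.YangMills.Theorems.AllWindowsColdBoxBoxHighLineLandauThirdOrderOfSizes

/-!
# LINE-20 «landau-rung3» compositions ON THE THEOREMS SIDE, modulo the two open cut-set sizes `hK3`/`hK4` of ✓`landauThirdOrder_of_sizes₂`
# (skeleton `Cruxes/BoxWindowHighSU2213/Lines/landau_rung3.lean` v4: `gaugeBallReductionSharp_of_strong`, `boxWindowUpTo_of`, `BoxWindowMid_of`,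
# `BoxWindowHighSU2213_of`, `BoxHighWindowsSU22_of`, transcribed with U1 ✓`stub_landauKernelPackage`, U2 ✓`stub_landauRepresentativeStrong`,
# U3 ✓`stub_landauBallUniqueness` BY NAME and U5 := ✓`landauThirdOrder_of_sizes₂ hK3 hK4`; planner ym-idea-2 g18 00:49:07Z «U5 by name = _of_sizes₂ K3 K4;
# the assembler step is unstaffed, any seat may propose it»; LINE-20 U5 ⟨stmt-QuantumFields-24336⟩ — U5 prep, helper-grade)

Width seat `ym-line-sfw-p2-w2` (g33).  The moment the row-sums `hK3` (fcl-p3 g27 + w3 g42) and `hK4` (w4 g30 over LEAD g78's rows) land: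
`boxWindowMid_of_sizes K3 K4 : BoxWindowSU22 (1/13) (1/11)` is the line's honest MID-window deliverable BY NAME, and
`BoxWindowHighSU2213_of_sizes K3 K4 : BoxWindowHighSU22 (1/11) → Theses.AllWindowsColdBox.BoxWindowHighSU2213` reduces ⟨24336⟩ to its declared residual U6 only.

* `gaugeBallReductionSharp_of_strong` / `gaugeBallReductionSharp` — U4 from U2 (the skeleton's v2 proof verbatim, Theorems-side);
* `landauRelativeComparisonBulk_of_sizes (hK3) (hK4) : θL < 1/10 → LandauRelativeComparisonBulk θL`; `boxTwoPointDomination_of_sizes`; ★`boxWindowMid_of_sizes`;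
  ★`BoxWindowHighSU2213_of_sizes`, `BoxHighWindowsSU22_of_sizes` (with the residual `BoxWindowHighSU22 (1/11)` as hypothesis).

HONEST LABEL: compositions CONDITIONAL on two open size statements (and, for ⟨24336⟩/⟨24004⟩, on the declared RG residual U6 `BoxWindowHighSU22 (1/11)`, NOT attacked);
U5, ⟨24336⟩, ⟨24004⟩ and the seat's own crux ⟨22884⟩ remain OPEN; route AllWindowsColdBox DRAFT; **the Yang–Mills mass gap is NOT proved by this file; no summit is
proved by a line.**
-/

set_option autoImplicit false

noncomputable section

open MeasureTheory Matrix
open Literature.MathematicalPhysics.QuantumFieldTheory hiding SU2 boxEdges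
open Literature.MathematicalPhysics.QuantumFieldTheory.LatticeMaxwell
open Literature.MathematicalPhysics.QuantumFieldTheory.AxialGauge
open Summit.QuantumFields.YangMills.Theorems.WeakCouplingRates
open Literature.Probability.LatticeModels (Site)

namespace Summit.QuantumFields.YangMills.Theorems.AllWindowsColdBoxBoxHighLine

namespace LandauRung3

open Literature.MathematicalPhysics.QuantumLattice in
/-- **U4 from U2** (LINE-20): the gauge-ball reduction with the SHARP interlock `κ < 1/2 − 2θL`, for every `θL < 1/10`, from the strong
small-Landau-representative bound `LandauRepresentativeBound` (premise `s·H³(1+log H) ≤ c₀`, conclusion `C·H²(1+log H)²·s²`).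
Exponents: `κ = 1/4 + θL/2` (so `3θL < κ < 1/2 − 2θL` iff `θL < 1/10`), `κ₂ = g = (1/10 − θL)/8`, `ε = 2θ + g`. -/
theorem gaugeBallReductionSharp_of_strong (h2 : LandauRepresentativeBound) :
    ∀ θL : ℝ, θL < 1 / 10 → ∃ κ : ℝ, 0 < κ ∧ κ < 1 / 2 - 2 * θL ∧ GaugeBallReduction θL κ := by
  intro θL hθL
  rcases le_or_gt 0 θL with hθL0 | hθLneg
  swap
  · -- vacuous range: no `θ` with `0 < θ ≤ θL`
    refine ⟨1 / 4, by norm_num, by linarith, 1, one_pos, fun θ hθ hθle => ?_⟩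
    exfalso; linarith
  refine ⟨1 / 4 + θL / 2, by linarith, by linarith, ?_⟩
  obtain ⟨C, c₀, hC, hc₀, h4⟩ := h2
  set g : ℝ := (1 / 10 - θL) / 8 with hg
  have hg0 : 0 < g := by rw [hg]; linarith
  refine ⟨g, hg0, fun θ hθ hθle => ?_⟩
  have hθ10 : θ < 1 / 10 := lt_of_le_of_lt hθle hθL
  set ε : ℝ := 2 * θ + g with hε
  have h2θε : 2 * θ < ε := by rw [hε]; linarith
  have hgε : g ≤ ε := by rw [hε]; linarith
  -- (R) rarity of large fields in the cold box
  obtain ⟨β₁, hrar⟩ := boxState_largeField_rarity hθ h2θε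
  -- (A) the U2 defect fits in the ball: `C (2H+3)² ((3+2/g) β^(g/2))² β^(2ε-1) ≤ β^(2κ-1)`
  obtain ⟨β₂, hβ₂1, hA⟩ := exists_const_mul_boxSide_pow_mul_rpow_le (C * (3 + 2 / g) ^ 2) 2
    (θ := θ) (a := g + (2 * ε - 1)) (b := 2 * (1 / 4 + θL / 2) - 1) hθ (by rw [hε, hg]; push_cast; nlinarith)
  -- (P) the U2 premise: `β^(ε-1/2) (2H+3)³ (3+2/g) β^(g/2) ≤ c₀`
  obtain ⟨β₃, hβ₃1, hP⟩ := exists_const_mul_boxSide_pow_mul_rpow_le ((3 + 2 / g) / c₀) 3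
    (θ := θ) (a := (ε - 1 / 2) + g / 2) (b := 0) hθ (by rw [hε, hg]; push_cast; nlinarith)
  refine ⟨max (max β₁ β₂) β₃, fun β hβ => ?_⟩
  have hβ1' : β₁ ≤ β := le_trans (le_trans (le_max_left _ _) (le_max_left _ _)) hβ
  have hβ2' : β₂ ≤ β := le_trans (le_trans (le_max_right _ _) (le_max_left _ _)) hβ
  have hβ3' : β₃ ≤ β := le_trans (le_max_right _ _) hβ
  have hβ1 : 1 ≤ β := hβ₂1.trans hβ2'
  have hβ0 : 0 < β := by linarith
  have hlog := one_add_log_boxSide_le (g := g) hβ1 hθ.le (by linarith) hg0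
  obtain ⟨hH1, hH2⟩ := one_le_ceil_rpow_and_le hβ1 hθ.le
  have hrarβ := hrar β hβ1'
  have hAβ := hA β hβ2'
  have hPβ := hP β hβ3'
  clear hrar hA hP
  set H : ℕ := ⌈β ^ θ⌉₊ with hH
  have hHnat : 1 ≤ H := by exact_mod_cast hH1
  have hlog0 : 0 ≤ 1 + Real.log (H : ℝ) := by linarith [Real.log_nonneg hH1]
  have hHle : (H : ℝ) ≤ 2 * (H : ℝ) + 3 := by linarith
  -- the small-plaquette scale `s = β^(ε - 1/2)`
  have hs0 : 0 ≤ β ^ (ε - 1 / 2) := by positivity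
  have hs2 : (β ^ (ε - 1 / 2)) ^ 2 = β ^ (2 * ε - 1) := by
    rw [← Real.rpow_natCast, ← Real.rpow_mul hβ0.le]; congr 1; push_cast; ring
  have hg2 : (β ^ (g / 2)) ^ 2 = β ^ g := by
    rw [← Real.rpow_natCast, ← Real.rpow_mul hβ0.le]; congr 1; push_cast; ring
  have hlogsq : (1 + Real.log (H : ℝ)) ^ 2 ≤ ((3 + 2 / g) * β ^ (g / 2)) ^ 2 := by gcongr
  -- premise of U2
  have hprem : β ^ (ε - 1 / 2) * (H : ℝ) ^ 3 * (1 + Real.log H) ≤ c₀ := by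
    rw [Real.rpow_zero] at hPβ
    have hH3 : (H : ℝ) ^ 3 ≤ (2 * (H : ℝ) + 3) ^ 3 := by gcongr
    have hsplit : β ^ (ε - 1 / 2 + g / 2) = β ^ (ε - 1 / 2) * β ^ (g / 2) := Real.rpow_add hβ0 _ _
    calc β ^ (ε - 1 / 2) * (H : ℝ) ^ 3 * (1 + Real.log H)
        ≤ β ^ (ε - 1 / 2) * (2 * (H : ℝ) + 3) ^ 3 * ((3 + 2 / g) * β ^ (g / 2)) := by gcongr
      _ = c₀ * ((3 + 2 / g) / c₀ * (2 * (H : ℝ) + 3) ^ 3 * β ^ (ε - 1 / 2 + g / 2)) := by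
          rw [hsplit]; field_simp
      _ ≤ c₀ * 1 := by gcongr
      _ = c₀ := mul_one _
  -- radius: the U2 defect bound fits inside the gauge ball of radius `β^(-1/2 + κ)`
  have hrad : C * (H : ℝ) ^ 2 * (1 + Real.log H) ^ 2 * (β ^ (ε - 1 / 2)) ^ 2 ≤ (β ^ (-(1 : ℝ) / 2 + (1 / 4 + θL / 2))) ^ 2 := by
    have hH2' : (H : ℝ) ^ 2 ≤ (2 * (H : ℝ) + 3) ^ 2 := by gcongr
    have hr2 : (β ^ (-(1 : ℝ) / 2 + (1 / 4 + θL / 2))) ^ 2 = β ^ (2 * (1 / 4 + θL / 2) - 1) := by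
      rw [← Real.rpow_natCast, ← Real.rpow_mul hβ0.le]; congr 1; push_cast; ring
    have hsplit : β ^ (g + (2 * ε - 1)) = β ^ g * β ^ (2 * ε - 1) := Real.rpow_add hβ0 _ _
    calc C * (H : ℝ) ^ 2 * (1 + Real.log H) ^ 2 * (β ^ (ε - 1 / 2)) ^ 2
        ≤ C * (2 * (H : ℝ) + 3) ^ 2 * ((3 + 2 / g) * β ^ (g / 2)) ^ 2 * (β ^ (ε - 1 / 2)) ^ 2 := by gcongr
      _ = C * (3 + 2 / g) ^ 2 * (2 * (H : ℝ) + 3) ^ 2 * β ^ (g + (2 * ε - 1)) := by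
          rw [hs2, mul_pow, hg2, hsplit]; ring
      _ ≤ β ^ (2 * (1 / 4 + θL / 2) - 1) := hAβ
      _ = (β ^ (-(1 : ℝ) / 2 + (1 / 4 + θL / 2))) ^ 2 := hr2.symm
  -- pointwise: cold wall ∧ no large field ⇒ in the gauge ball (via U2)
  have hpt : ∀ U : LGConfig 4 SU2, ColdWall H U → U ∈ coldGoodSet β ε H →
      InGaugeBall H (β ^ (-(1 : ℝ) / 2 + (1 / 4 + θL / 2))) U := by
    intro U hcold hgood
    have hgood' : ∀ p ∈ plaquettesTouching (boxEdges 4 (2 * H + 1)),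
        plaqCostAt (fundamentalRep (Fin 2)) p.1 p.2.1.1 p.2.1.2 U < (β ^ (ε - 1 / 2)) ^ 2 := by
      simp only [coldGoodSet, Set.mem_compl_iff, Set.mem_setOf_eq, not_exists, not_and, not_le] at hgood
      intro p hp
      have := hgood p hp
      rw [hs2]; unfold plaqCostAt; push_cast; linarith
    have hsmall : SmallPlaquettes H (β ^ (ε - 1 / 2)) U := smallPlaquettes_of_coldWall_of_good hcold hgood'
    obtain ⟨gT, hgT, -, hdef⟩ := h4 H hHnat _ hs0 hprem U hcold hsmall
    exact ⟨gT, hgT, fun e he => (hdef e he).trans hrad⟩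
  -- measure bound: cold wall a.s. (DLR properness), then monotonicity + rarity
  have hγ : Literature.Probability.LatticeModels.IsSpecification (ymSpecification (d := 4) (fundamentalRep (Fin 2)) β) :=
    isSpecification_ymSpecification_of_t2Space (fundamentalRep (Fin 2)) (continuous_fundamentalRep (Fin 2)) β
  have hae : ∀ᵐ U ∂(boxState (fundamentalRep (Fin 2)) β H), ColdWall H U := by
    have hprop := hγ.proper (boxEdges 4 (2 * H + 1)) (fun _ => 1)
    show ∀ᵐ U ∂(ymSpecification (fundamentalRep (Fin 2)) β (boxEdges 4 (2 * H + 1)) (fun _ => 1)), ColdWall H U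
    filter_upwards [hprop] with U hU
    exact fun e he => hU e he
  have hmono : boxState (fundamentalRep (Fin 2)) β H {U | ¬ InGaugeBall H (β ^ (-(1 : ℝ) / 2 + (1 / 4 + θL / 2))) U} ≤
      boxState (fundamentalRep (Fin 2)) β H (coldGoodSet β ε H)ᶜ := by
    refine measure_mono_ae ?_
    filter_upwards [hae] with U hU
    intro hnot
    exact Set.mem_compl fun hgoodc => hnot (hpt U hU hgoodc)
  haveI : IsFiniteMeasure (boxState (fundamentalRep (Fin 2)) β H) := by
    unfold boxState ymSpecification; infer_instance
  have hset : (coldGoodSet β ε H)ᶜ = {U : LGConfig 4 SU2 | ∃ p ∈ plaquettesTouching (boxEdges 4 (2 * H + 1)),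
      β ^ (2 * ε - 1) ≤ (2 : ℝ) - plaquetteObs (fundamentalRep (Fin 2)) p.1 p.2.1.1 p.2.1.2 U} := by
    rw [coldGoodSet, compl_compl]
  calc boxState (fundamentalRep (Fin 2)) β H {U | ¬ InGaugeBall H (β ^ (-(1 : ℝ) / 2 + (1 / 4 + θL / 2))) U}
      ≤ boxState (fundamentalRep (Fin 2)) β H (coldGoodSet β ε H)ᶜ := hmono
    _ = ENNReal.ofReal ((boxState (fundamentalRep (Fin 2)) β H).real (coldGoodSet β ε H)ᶜ) :=
        (ENNReal.ofReal_toReal (measure_ne_top _ _)).symm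
    _ ≤ ENNReal.ofReal (Real.exp (-(β ^ ε))) := by
        apply ENNReal.ofReal_le_ofReal
        rw [hset]; exact hrarβ
    _ ≤ ENNReal.ofReal (Real.exp (-(β ^ g))) := by
        apply ENNReal.ofReal_le_ofReal
        apply Real.exp_le_exp.2
        have : β ^ g ≤ β ^ ε := Real.rpow_le_rpow_of_exponent_le hβ1 hgε
        linarith

/-- **U4 (gauge-ball reduction with the SHARP interlock) — NOT a stub (v2): proved from U2.**  For every θL < 1/10 the radius exponent
`κ = 1/4 + θL/2` satisfies `3θL < κ < 1/2 − 2θL` (non-empty iff θL < 1/10; at θL = 1/11: κ = 13/44 ∈ (3/11, 7/22)) and makes the complement of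
the gauge ball exponentially rare.  The upper bound `κ < 1/2 − 2θL` is what U5 consumes (U3 at radius `β^(κ−1/2)`: `r·H → 0`; convexity: `r·H² → 0`). -/
theorem gaugeBallReductionSharp :
    ∀ θL : ℝ, θL < 1 / 10 → ∃ κ : ℝ, 0 < κ ∧ κ < 1 / 2 - 2 * θL ∧ GaugeBallReduction θL κ :=
  gaugeBallReductionSharp_of_strong stub_landauRepresentativeStrong

/-! ## The chain modulo the two cut-set sizes -/

section Sizes

variable
    (hK3 : ∀ θ : ℝ, 0 < θ → θ < 1 / 10 → ∃ q : ℝ, ∃ K : ℝ → ℕ → ℝ,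
      (∃ β₀ : ℝ, 1 ≤ β₀ ∧ ∀ β : ℝ, β₀ ≤ β → ∀ H : ℕ, 1 ≤ H → β ^ θ ≤ (H : ℝ) → (H : ℝ) ≤ β ^ θ + 1 →
        ∀ D : Set (LandauFree H → E3), MeasurableSet D → D ⊆ smallField H (β ^ ((1 / 8 - θ / 4) - 1 / 2)) → (∀ a, -a ∈ D ↔ a ∈ D) →
        gaussAvg β H (fun a => 1 - D.indicator (fun _ => (1 : ℝ)) a) ≤ β ^ (-q) →
        gaussAvg β H (fun a => 1 - D.indicator (fun _ => (1 : ℝ)) a) ≤ 1 / 2 → (∀ a ∈ D, |tiltU β H a| ≤ 2) → ∀ x y : Site 4,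
        |Tilt.tiltCum3 (((volume : Measure (LandauFree H → E3)).restrict D).withDensity fun a => ENNReal.ofReal (gaussWeight β H a))
            (tiltU β H) 0 (chartPlaqCost H x 1 2) (chartPlaqCost H y 1 2)| ≤ K β H) ∧
      (∀ ε : ℝ, 0 < ε → ∃ β₀ : ℝ, 1 ≤ β₀ ∧ ∀ β : ℝ, β₀ ≤ β → ∀ H : ℕ, 1 ≤ H → (H : ℝ) ≤ β ^ θ + 1 → β ^ 2 * (H : ℝ) ^ 8 * K β H ≤ ε))
    (hK4 : ∀ θ : ℝ, 0 < θ → θ < 1 / 10 → ∃ q : ℝ, ∃ K : ℝ → ℕ → ℝ,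
      (∃ β₀ : ℝ, 1 ≤ β₀ ∧ ∀ β : ℝ, β₀ ≤ β → ∀ H : ℕ, 1 ≤ H → β ^ θ ≤ (H : ℝ) → (H : ℝ) ≤ β ^ θ + 1 →
        ∀ D : Set (LandauFree H → E3), MeasurableSet D → D ⊆ smallField H (β ^ ((1 / 8 - θ / 4) - 1 / 2)) → (∀ a, -a ∈ D ↔ a ∈ D) →
        gaussAvg β H (fun a => 1 - D.indicator (fun _ => (1 : ℝ)) a) ≤ β ^ (-q) →
        gaussAvg β H (fun a => 1 - D.indicator (fun _ => (1 : ℝ)) a) ≤ 1 / 2 → (∀ a ∈ D, |tiltU β H a| ≤ 2) → ∀ x y : Site 4,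
        |Tilt.tiltCum4 (((volume : Measure (LandauFree H → E3)).restrict D).withDensity fun a => ENNReal.ofReal (gaussWeight β H a))
            (tiltU β H) 0 (chartPlaqCost H x 1 2) (chartPlaqCost H y 1 2)| ≤ K β H) ∧
      (∀ ε : ℝ, 0 < ε → ∃ β₀ : ℝ, 1 ≤ β₀ ∧ ∀ β : ℝ, β₀ ≤ β → ∀ H : ℕ, 1 ≤ H → (H : ℝ) ≤ β ^ θ + 1 → β ^ 2 * (H : ℝ) ^ 8 * K β H ≤ ε))

include hK3 hK4

/-- U5 := ✓`landauThirdOrder_of_sizes₂ hK3 hK4` with U1–U4 BY NAME: the bulk relative Dirichlet comparison for every `θL < 1/10`. -/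
theorem landauRelativeComparisonBulk_of_sizes {θL : ℝ} (hθL : θL < 1 / 10) : LandauRelativeComparisonBulk θL :=
  landauThirdOrder_of_sizes₂ hK3 hK4 θL hθL stub_landauKernelPackage stub_landauRepresentativeStrong stub_landauBallUniqueness
    (gaugeBallReductionSharp θL hθL)

/-- Cold-box two-point domination for all windows `0 < A < θ ≤ θL`, `θL < 1/10` (bulk currency ✓`boxWindow_of_dirichletDominationBulk_ceiling`). -/
theorem boxTwoPointDomination_of_sizes {θL : ℝ} (hθL : θL < 1 / 10) (A θ : ℝ) (hA : 0 < A) (hAθ : A < θ) (hθ : θ ≤ θL) :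
    ∃ c : ℝ, 0 < c ∧ BoxTwoPointDomination (G := SU2) (Literature.MathematicalPhysics.QuantumLattice.fundamentalRep (Fin 2)) A θ c :=
  boxWindow_of_dirichletDominationBulk_ceiling θL (landauRelativeComparisonBulk_of_sizes hK3 hK4 hθL) A θ hA hAθ hθ

/-- ★ **The line's honest deliverable modulo the two sizes: the MID window `1/13 < θ ≤ 1/11`.** -/
theorem boxWindowMid_of_sizes : BoxWindowSU22 (1 / 13) (1 / 11) :=
  fun A θ hA hAθ _h7 _hlo hhi => boxTwoPointDomination_of_sizes hK3 hK4 (θL := 1 / 11) (by norm_num) A θ hA hAθ hhi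

/-- ★ **⟨stmt-QuantumFields-24336⟩ modulo the two sizes and the declared residual U6** (`BoxWindowHighSU22 (1/11)`, RG regime, NOT attacked). -/
theorem BoxWindowHighSU2213_of_sizes (hres : BoxWindowHighSU22 (1 / 11)) :
    Summit.QuantumFields.YangMills.Theses.AllWindowsColdBox.BoxWindowHighSU2213 := by
  intro A θ hA hAθ h7 _h13
  by_cases hθ : θ ≤ 1 / 11
  · exact boxTwoPointDomination_of_sizes hK3 hK4 (θL := 1 / 11) (by norm_num) A θ hA hAθ hθ
  · exact hres A θ hA hAθ h7 (lt_of_not_ge hθ)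

/-- The parent crux ⟨stmt-QuantumFields-24004⟩ modulo the two sizes and the same residual. -/
theorem BoxHighWindowsSU22_of_sizes (hres : BoxWindowHighSU22 (1 / 11)) :
    Summit.QuantumFields.YangMills.Theses.AllWindowsColdBox.BoxHighWindowsSU22 := by
  intro A θ hA hAθ h7 _h16
  by_cases hθ : θ ≤ 1 / 11
  · exact boxTwoPointDomination_of_sizes hK3 hK4 (θL := 1 / 11) (by norm_num) A θ hA hAθ hθ
  · exact hres A θ hA hAθ h7 (lt_of_not_ge hθ)

end Sizes

end LandauRung3

end Summit.QuantumFields.YangMills.Theorems.AllWindowsColdBoxBoxHighLine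

end
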